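import Literature.NumberTheory.Automorphic.BianchiConeHoroballs
import Literature.NumberTheory.NumberFields.ImaginaryQuadraticEmbedding
import Mathlib.RingTheory.Ideal.Norm.AbsNorm
import Mathlib.NumberTheory.NumberField.Basic
import HarnessLib

/-!
# The depth of a binary Hermitian form at a cusp of a Bianchi group

Topic `NumberTheory/Automorphic`; namespace `Literature.NumberTheory.Automorphic`, grouping
sub-namespace `BianchiCusp`.  Definitions with body and theorems.

Let `K` be an imaginary quadratic field with complex embedding `σ`, `Γ = GL₂(𝓞_K)` acting on the
cone `𝒫` of positive definite binary Hermitian forms through `σ` (`BianchiConeModel.act`).  A cusp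
is the line of a non-zero INTEGRAL vector `v ∈ 𝓞_K²`; put `𝔞_v = (v₀, v₁)` (`idealOf`) and
define the DEPTH of `H` at `v` ([ElstrodtGrunewaldMennicke1998, Ch. 7 §7.2, the function
measuring the distance to the cusp `v`; [Swan1971, §3]):

  `depth σ v H = H[σ v] / (N𝔞_v · √det H)`.

* `idealOf_mulVec` — `𝔞_{γ v} = 𝔞_v` for `γ ∈ Γ`; `idealOf_smul` — `𝔞_{c v} = (c) 𝔞_v`;
* `depth_smul_act` — **invariance** `depth (γ v) (γ • H) = depth v H`; `depth_cmul` — `depth (c v) H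
  = depth v H` (`c ≠ 0`); `depth_smul_mat` — homogeneity of degree `0` in `H`;
* `one_le_depth_mul_depth` — **disjointness of horoballs at distinct cusps**:
  `depth v H · depth w H ≥ 1` unless `v ∥ w` (the product inequality of `BianchiConeHoroballs`
  and `|N(v₀w₁ - v₁w₀)| ≥ N𝔞_v N𝔞_w`);
* `coer_div_rdet_le_depth` — **every cusp is uniformly far on compacta**:
  `depth v H ≥ coer H / rdet H` (`N𝔞_v ≤ |N(v_i)| = |σ v_i|²`).

## References

* J. Elstrodt, F. Grunewald, J. Mennicke, *Groups Acting on Hyperbolic Space* (1998), Ch. 7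
  §7.2 [ElstrodtGrunewaldMennicke1998].
* R. G. Swan, *Generators and relations for certain special linear groups*, Adv. Math. 6 (1971),
  §3 [Swan1971].
-/

noncomputable section

open Matrix Complex NumberField
open scoped MatrixGroups ComplexConjugate

namespace Literature.NumberTheory.Automorphic

namespace BianchiCusp

open BianchiCone Literature.NumberTheory.NumberFields

variable {K : Type*} [Field K] (σ : K →+* ℂ)

/-- Integral vectors `𝓞_K²`. [folklore] -/
abbrev OVec (K : Type*) [Field K] : Type _ := Fin 2 → 𝓞 K

/-- The image of an integral vector in `ℂ²`. [folklore] -/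
def emb (v : OVec K) : Vec := fun i => σ (v i)

/-- Unfolding lemma for `emb`. [folklore] -/
@[simp]
theorem emb_apply (v : OVec K) (i : Fin 2) : emb σ v i = σ (v i) := rfl

/-- **`GL₂(𝓞_K) → GL₂(ℂ)`** through `σ`. [folklore] -/
def toGL : GL (Fin 2) (𝓞 K) →* GL (Fin 2) ℂ :=
  Matrix.GeneralLinearGroup.map (σ.comp (algebraMap (𝓞 K) K))

/-- Entries of `toGL σ γ`. [folklore] -/
@[simp]
theorem toGL_apply (γ : GL (Fin 2) (𝓞 K)) (i j : Fin 2) : (toGL σ γ : Mat) i j = σ ((γ : Matrix (Fin 2) (Fin 2) (𝓞 K)) i j) :=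
  Matrix.GeneralLinearGroup.map_apply _ i j γ

/-- `toGL σ γ` acts on embedded vectors as `γ` acts on integral vectors. [folklore] -/
theorem toGL_mulVec_emb (γ : GL (Fin 2) (𝓞 K)) (v : OVec K) :
    (toGL σ γ : Mat) *ᵥ emb σ v = emb σ ((γ : Matrix (Fin 2) (Fin 2) (𝓞 K)) *ᵥ v) := by
  funext i
  simp [mulVec, dotProduct, Fin.sum_univ_two]

/-- The determinant of `toGL σ γ` has absolute value `1` (`det γ` is a unit of `𝓞_K`).
[folklore] -/
theorem norm_det_toGL [NumberField K] [IsTotallyComplex K] (hK : Module.finrank ℚ K = 2) (γ : GL (Fin 2) (𝓞 K)) :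
    ‖(toGL σ γ : Mat).det‖ = 1 := by
  have h : (toGL σ γ : Mat).det = σ ((γ : Matrix (Fin 2) (Fin 2) (𝓞 K)).det) := by
    rw [show (toGL σ γ : Mat) = (σ.comp (algebraMap (𝓞 K) K)).mapMatrix (γ : Matrix (Fin 2) (Fin 2) (𝓞 K)) from rfl,
      ← RingHom.map_det]
    rfl
  rw [h]
  exact ImaginaryQuadratic.norm_eq_one_of_isUnit hK σ
    ((Matrix.isUnits_det_units γ))

/-! ### The ideal of a vector -/

/-- **`𝔞_v = (v₀, v₁)`**, the ideal generated by the coordinates. [cite: ElstrodtGrunewaldMennicke1998, Ch. 7 §7.2] -/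
def idealOf (v : OVec K) : Ideal (𝓞 K) :=
  Ideal.span {v 0, v 1}

/-- The coordinates lie in `𝔞_v`. [folklore] -/
theorem apply_mem_idealOf (v : OVec K) (i : Fin 2) : v i ∈ idealOf v := by
  fin_cases i
  · exact Ideal.subset_span (Set.mem_insert _ _)
  · exact Ideal.subset_span (Set.mem_insert_of_mem _ rfl)

/-- `𝔞_v = 0` iff `v = 0`. [folklore] -/
theorem idealOf_eq_bot_iff (v : OVec K) : idealOf v = ⊥ ↔ v = 0 := by
  constructor
  · intro h
    funext i
    have := apply_mem_idealOf v i
    rw [h, Ideal.mem_bot] at this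
    exact this
  · rintro rfl
    simp [idealOf]

/-- The coordinates of `γ v` lie in `𝔞_v`. [folklore] -/
theorem mulVec_apply_mem_idealOf (M : Matrix (Fin 2) (Fin 2) (𝓞 K)) (v : OVec K) (i : Fin 2) :
    (M *ᵥ v) i ∈ idealOf v := by
  simp only [mulVec, dotProduct, Fin.sum_univ_two]
  exact Ideal.add_mem _ (Ideal.mul_mem_left _ _ (apply_mem_idealOf v 0))
    (Ideal.mul_mem_left _ _ (apply_mem_idealOf v 1))

/-- `𝔞_{M v} ≤ 𝔞_v`. [folklore] -/
theorem idealOf_mulVec_le (M : Matrix (Fin 2) (Fin 2) (𝓞 K)) (v : OVec K) : idealOf (M *ᵥ v) ≤ idealOf v := by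
  rw [idealOf, Ideal.span_le]
  rintro x (rfl | rfl)
  · exact mulVec_apply_mem_idealOf M v 0
  · exact mulVec_apply_mem_idealOf M v 1

/-- **`𝔞_{γ v} = 𝔞_v` for `γ ∈ GL₂(𝓞_K)`.** [cite: ElstrodtGrunewaldMennicke1998, Ch. 7 §7.2] -/
theorem idealOf_mulVec (γ : GL (Fin 2) (𝓞 K)) (v : OVec K) :
    idealOf ((γ : Matrix (Fin 2) (Fin 2) (𝓞 K)) *ᵥ v) = idealOf v := by
  refine le_antisymm (idealOf_mulVec_le _ v) ?_
  conv_lhs => rw [show v = ((γ⁻¹ : GL (Fin 2) (𝓞 K)) : Matrix (Fin 2) (Fin 2) (𝓞 K)) *ᵥ ((γ : Matrix (Fin 2) (Fin 2) (𝓞 K)) *ᵥ v) by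
    rw [mulVec_mulVec, ← Units.val_mul, inv_mul_cancel, Units.val_one, one_mulVec]]
  exact idealOf_mulVec_le _ _

/-- **`𝔞_{c v} = (c) 𝔞_v`.** [folklore] -/
theorem idealOf_smul (c : 𝓞 K) (v : OVec K) : idealOf (c • v) = Ideal.span {c} * idealOf v := by
  rw [idealOf, idealOf, Ideal.span_mul_span', Set.singleton_mul, Set.image_pair]
  rfl

section Norms

variable [NumberField K]

/-- `N𝔞_v > 0` for `v ≠ 0`. [folklore] -/
theorem absNorm_idealOf_pos {v : OVec K} (hv : v ≠ 0) : 0 < Ideal.absNorm (idealOf v) := by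
  rw [Nat.pos_iff_ne_zero, Ne, Ideal.absNorm_eq_zero_iff, idealOf_eq_bot_iff]
  exact hv

/-- **`N𝔞_{c v} = |N c| N𝔞_v`.** [folklore] -/
theorem absNorm_idealOf_smul (c : 𝓞 K) (v : OVec K) :
    Ideal.absNorm (idealOf (c • v)) = (Algebra.norm ℤ c).natAbs * Ideal.absNorm (idealOf v) := by
  rw [idealOf_smul, map_mul, Ideal.absNorm_span_singleton]

/-- `N𝔞_v ≤ |N(v_i)|` for a non-zero coordinate. [folklore] -/
theorem absNorm_idealOf_le {v : OVec K} {i : Fin 2} (hi : v i ≠ 0) :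
    Ideal.absNorm (idealOf v) ≤ (Algebra.norm ℤ (v i)).natAbs := by
  have hle : Ideal.span {v i} ≤ idealOf v := (Ideal.span_singleton_le_iff_mem _).2 (apply_mem_idealOf v i)
  have hdvd := Ideal.absNorm_dvd_absNorm_of_le hle
  rw [Ideal.absNorm_span_singleton] at hdvd
  refine Nat.le_of_dvd (Nat.pos_iff_ne_zero.2 ?_) hdvd
  rw [Ne, Int.natAbs_eq_zero, Algebra.norm_eq_zero_iff]
  exact hi

/-! ### The depth -/

/-- **The depth of `H` at the cusp of `v`**: `H[σ v] / (N𝔞_v √det H)`.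
[cite: ElstrodtGrunewaldMennicke1998, Ch. 7 §7.2] -/
def depth (v : OVec K) (H : Mat) : ℝ :=
  qf H (emb σ v) / ((Ideal.absNorm (idealOf v) : ℝ) * rdet H)

/-- The depth is non-negative on the cone. [folklore] -/
theorem depth_nonneg {v : OVec K} {H : Mat} (hH : H ∈ cone) : 0 ≤ depth σ v H := by
  unfold depth
  refine div_nonneg ?_ (mul_nonneg (Nat.cast_nonneg _) (rdet_nonneg H))
  by_cases hv : emb σ v = 0
  · rw [hv, qf]; simp
  · exact (qf_pos hH hv).le

/-- `emb` is injective. [folklore] -/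
theorem emb_eq_zero_iff {v : OVec K} : emb σ v = 0 ↔ v = 0 := by
  constructor
  · intro h
    funext i
    have hi := congrFun h i
    rw [emb_apply, Pi.zero_apply, map_eq_zero, ← map_zero (algebraMap (𝓞 K) K)] at hi
    exact IsFractionRing.injective (𝓞 K) K hi
  · rintro rfl
    funext i
    simp [emb]

/-- The depth is positive on the cone for `v ≠ 0`. [folklore] -/
theorem depth_pos {v : OVec K} (hv : v ≠ 0) {H : Mat} (hH : H ∈ cone) : 0 < depth σ v H := by
  unfold depth
  refine div_pos (qf_pos hH fun h => hv ((emb_eq_zero_iff σ).1 h)) (mul_pos ?_ (rdet_pos hH))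
  exact_mod_cast absNorm_idealOf_pos hv

omit [NumberField K] in
/-- `emb (c • v) = σ c • emb v`. [folklore] -/
theorem emb_smul (c : 𝓞 K) (v : OVec K) : emb σ (c • v) = (σ c : ℂ) • emb σ v := by
  funext i
  simp [emb]

/-- `H[t v] = |t|² H[v]` for a complex scalar. [folklore] -/
theorem qf_smul_vec (H : Mat) (t : ℂ) (v : Vec) : qf H (t • v) = Complex.normSq t * qf H v := by
  have h : star (t • v) ⬝ᵥ (H *ᵥ (t • v)) = (Complex.normSq t : ℂ) * (star v ⬝ᵥ (H *ᵥ v)) := by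
    rw [mulVec_smul, dotProduct_smul, star_smul, smul_dotProduct, smul_smul, Complex.star_def, smul_eq_mul,
      Complex.mul_conj]
  rw [qf, qf, h, Complex.re_ofReal_mul]

/-- **Scalar invariance**: `depth (c v) H = depth v H` for `c ∈ 𝓞_K`, `c ≠ 0` (the depth depends
only on the cusp). [cite: ElstrodtGrunewaldMennicke1998, Ch. 7 §7.2] -/
theorem depth_cmul [IsTotallyComplex K] (hK : Module.finrank ℚ K = 2) {c : 𝓞 K} (hc : c ≠ 0)
    (v : OVec K) (H : Mat) : depth σ (c • v) H = depth σ v H := by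
  unfold depth
  rw [emb_smul, qf_smul_vec, absNorm_idealOf_smul, Nat.cast_mul, Complex.normSq_eq_norm_sq,
    ImaginaryQuadratic.norm_sq_eq_natAbs_norm hK σ c]
  have hn : ((Algebra.norm ℤ c).natAbs : ℝ) ≠ 0 := by
    rw [Nat.cast_ne_zero, Ne, Int.natAbs_eq_zero, Algebra.norm_eq_zero_iff]
    exact hc
  rw [mul_assoc, mul_div_mul_left _ _ hn]

/-- **Homogeneity**: `depth v (t H) = depth v H` for `t > 0`. [folklore] -/
theorem depth_smul_mat {t : ℝ} (ht : 0 < t) (v : OVec K) (H : Mat) :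
    depth σ v (t • H) = depth σ v H := by
  unfold depth
  rw [qf_smul, rdet_smul ht.le, mul_left_comm, mul_div_mul_left _ _ ht.ne']

/-- **Invariance under `Γ`**: `depth (γ v) (γ • H) = depth v H`. [cite: ElstrodtGrunewaldMennicke1998, Ch. 7 §7.2] -/
theorem depth_mulVec_act [IsTotallyComplex K] (hK : Module.finrank ℚ K = 2) (γ : GL (Fin 2) (𝓞 K))
    (v : OVec K) {H : Mat} (hH : H.IsHermitian) :
    depth σ ((γ : Matrix (Fin 2) (Fin 2) (𝓞 K)) *ᵥ v) (act (toGL σ γ) H) = depth σ v H := by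
  unfold depth
  rw [← toGL_mulVec_emb, qf_act_mulVec, idealOf_mulVec, rdet_act _ hH, norm_det_toGL σ hK, div_one]

/-- The form of `H` at `γ⁻¹ • H`: `depth v (γ⁻¹ • H) = depth (γ v) H`. [folklore] -/
theorem depth_act_inv [IsTotallyComplex K] (hK : Module.finrank ℚ K = 2) (γ : GL (Fin 2) (𝓞 K))
    (v : OVec K) {H : Mat} (hH : H.IsHermitian) :
    depth σ v (act (toGL σ γ)⁻¹ H) = depth σ ((γ : Matrix (Fin 2) (Fin 2) (𝓞 K)) *ᵥ v) H := by
  have h := depth_mulVec_act σ hK γ v (isHermitian_act (toGL σ γ)⁻¹ hH)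
  rw [← act_mul, ← map_inv, ← map_mul, mul_inv_cancel, map_one, act_one] at h
  exact h.symm

/-! ### Disjointness of horoballs at distinct cusps -/

/-- `det2` of embedded vectors. [folklore] -/
theorem det2_emb (v w : OVec K) : det2 (emb σ v) (emb σ w) = σ ((v 0 * w 1 - v 1 * w 0 : 𝓞 K) : K) := by
  simp [det2, emb]

omit [NumberField K] in
/-- `v₀ w₁ - v₁ w₀ ∈ 𝔞_v 𝔞_w`. [folklore] -/
theorem det2_mem_mul (v w : OVec K) : v 0 * w 1 - v 1 * w 0 ∈ idealOf v * idealOf w :=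
  Ideal.sub_mem _ (Ideal.mul_mem_mul (apply_mem_idealOf v 0) (apply_mem_idealOf w 1))
    (Ideal.mul_mem_mul (apply_mem_idealOf v 1) (apply_mem_idealOf w 0))

/-- `N𝔞_v N𝔞_w ≤ |N(v₀w₁ - v₁w₀)|` when the vectors are not parallel. [folklore] -/
theorem absNorm_mul_le_norm_det2 {v w : OVec K} (h : v 0 * w 1 - v 1 * w 0 ≠ 0) :
    Ideal.absNorm (idealOf v) * Ideal.absNorm (idealOf w) ≤ (Algebra.norm ℤ (v 0 * w 1 - v 1 * w 0)).natAbs := by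
  rw [← map_mul]
  have hle : Ideal.span {v 0 * w 1 - v 1 * w 0} ≤ idealOf v * idealOf w :=
    (Ideal.span_singleton_le_iff_mem _).2 (det2_mem_mul v w)
  have hdvd := Ideal.absNorm_dvd_absNorm_of_le hle
  rw [Ideal.absNorm_span_singleton] at hdvd
  refine Nat.le_of_dvd (Nat.pos_iff_ne_zero.2 ?_) hdvd
  rw [Ne, Int.natAbs_eq_zero, Algebra.norm_eq_zero_iff]
  exact h

/-- **Disjointness of horoballs at distinct cusps**: if `v, w ∈ 𝓞_K²` are not parallel then
`depth v H · depth w H ≥ 1` for every `H` in the cone; hence the horoball cones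
`{depth < τ}`, `τ ≤ 1`, at distinct cusps are disjoint. [cite: ElstrodtGrunewaldMennicke1998, Ch. 7 §7.2] -/
theorem one_le_depth_mul_depth [IsTotallyComplex K] (hK : Module.finrank ℚ K = 2) {v w : OVec K}
    (h : v 0 * w 1 - v 1 * w 0 ≠ 0) {H : Mat} (hH : H ∈ cone) :
    1 ≤ depth σ v H * depth σ w H := by
  have hv : v ≠ 0 := by rintro rfl; exact h (by simp)
  have hw : w ≠ 0 := by rintro rfl; exact h (by simp)
  have hNv : (0 : ℝ) < Ideal.absNorm (idealOf v) := by exact_mod_cast absNorm_idealOf_pos hv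
  have hNw : (0 : ℝ) < Ideal.absNorm (idealOf w) := by exact_mod_cast absNorm_idealOf_pos hw
  have hr := rdet_pos hH
  have hprod := qf_mul_qf_ge hH (emb σ v) (emb σ w)
  rw [det2_emb, ImaginaryQuadratic.norm_sq_eq_natAbs_norm hK σ] at hprod
  have hN : (Ideal.absNorm (idealOf v) : ℝ) * Ideal.absNorm (idealOf w) ≤
      ((Algebra.norm ℤ (v 0 * w 1 - v 1 * w 0)).natAbs : ℝ) := by
    exact_mod_cast absNorm_mul_le_norm_det2 h
  unfold depth
  rw [div_mul_div_comm, le_div_iff₀ (by positivity), one_mul]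
  have hd : rdet H * rdet H = hdet H := by rw [← sq, rdet_sq hH]
  calc (Ideal.absNorm (idealOf v) : ℝ) * rdet H * ((Ideal.absNorm (idealOf w)) * rdet H)
      = (Ideal.absNorm (idealOf v) : ℝ) * Ideal.absNorm (idealOf w) * hdet H := by rw [← hd]; ring
    _ ≤ ((Algebra.norm ℤ (v 0 * w 1 - v 1 * w 0)).natAbs : ℝ) * hdet H :=
        mul_le_mul_of_nonneg_right hN hH.2.2.le
    _ = hdet H * ((Algebra.norm ℤ (v 0 * w 1 - v 1 * w 0)).natAbs : ℝ) := mul_comm _ _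
    _ ≤ qf H (emb σ v) * qf H (emb σ w) := hprod

/-- **Horoball cones of parameter `≤ 1` at non-parallel cusps are disjoint.** [cite: ElstrodtGrunewaldMennicke1998, Ch. 7 §7.2] -/
theorem det2_eq_zero_of_depth_lt_one [IsTotallyComplex K] (hK : Module.finrank ℚ K = 2) {v w : OVec K}
    {H : Mat} (hH : H ∈ cone) (hv : depth σ v H < 1) (hw : depth σ w H < 1) :
    v 0 * w 1 - v 1 * w 0 = 0 := by
  by_contra h
  have h1 := one_le_depth_mul_depth σ hK h hH
  have h2 : depth σ v H * depth σ w H < 1 := by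
    calc depth σ v H * depth σ w H ≤ depth σ v H * 1 :=
          mul_le_mul_of_nonneg_left hw.le (depth_nonneg σ hH)
      _ < 1 := by rw [mul_one]; exact hv
  linarith

/-! ### A uniform lower bound -/

/-- **`depth v H ≥ coer H / rdet H`** for every non-zero integral `v`: on a compact subset of the
cone all cusps are uniformly deep (`N𝔞_v ≤ |σ v_i|²`). [cite: ElstrodtGrunewaldMennicke1998, Ch. 7 §7.2] -/
theorem coer_div_rdet_le_depth [IsTotallyComplex K] (hK : Module.finrank ℚ K = 2) {v : OVec K} (hv : v ≠ 0)
    {H : Mat} (hH : H ∈ cone) : coer H / rdet H ≤ depth σ v H := by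
  have hr := rdet_pos hH
  have hc := coer_pos hH
  have hN0 : (0 : ℝ) < Ideal.absNorm (idealOf v) := by exact_mod_cast absNorm_idealOf_pos hv
  -- `N𝔞_v ≤ |σ v₀|² + |σ v₁|²`
  have hN : (Ideal.absNorm (idealOf v) : ℝ) ≤ Complex.normSq (emb σ v 0) + Complex.normSq (emb σ v 1) := by
    have hi : ∃ i, v i ≠ 0 := by
      by_contra h
      apply hv
      funext i
      by_contra hi
      exact h ⟨i, hi⟩
    obtain ⟨i, hi⟩ := hi
    have h1 : (Ideal.absNorm (idealOf v) : ℝ) ≤ Complex.normSq (emb σ v i) := by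
      rw [emb_apply, Complex.normSq_eq_norm_sq, ImaginaryQuadratic.norm_sq_eq_natAbs_norm hK σ]
      exact_mod_cast absNorm_idealOf_le hi
    fin_cases i
    · exact h1.trans (le_add_of_nonneg_right (Complex.normSq_nonneg _))
    · exact h1.trans (le_add_of_nonneg_left (Complex.normSq_nonneg _))
  have hq := qf_ge_coer hH (emb σ v)
  unfold depth
  rw [div_le_div_iff₀ hr (mul_pos hN0 hr)]
  calc coer H * ((Ideal.absNorm (idealOf v) : ℝ) * rdet H)
      = (coer H * Ideal.absNorm (idealOf v)) * rdet H := by ring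
    _ ≤ (coer H * (Complex.normSq (emb σ v 0) + Complex.normSq (emb σ v 1))) * rdet H :=
        mul_le_mul_of_nonneg_right (mul_le_mul_of_nonneg_left hN hc.le) hr.le
    _ ≤ qf H (emb σ v) * rdet H := mul_le_mul_of_nonneg_right hq hr.le

end Norms

end BianchiCusp

end Literature.NumberTheory.Automorphic
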